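import Literature.AlgebraicGeometry.Resolution.AlterationsStrong
import Mathlib.AlgebraicGeometry.Morphisms.QuasiCompact
import HarnessLib

/-!
# `ModificationsResolve` (crux stmt-ResolutionOfSingularities-18507), line `Sketch` —
stub `stub_exists_nat_topologicalKrullDim_le` (finite type over a field ⇒ finite dimensional)

Helper file (`--supports stmt-ResolutionOfSingularities-18507`; does not close the item).

**Statement.** A scheme `X` quasi-compact and locally of finite type over `Spec k`, `k` a field,
has `topologicalKrullDim X ≤ d` for some natural number `d`.

**Proof.** Over the affine base `Spec k`, `QuasiCompact f` is `CompactSpace X`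
(`HasAffineProperty.iff_of_isAffine` for `@QuasiCompact`); then the tree lemma
`Literature.AlgebraicGeometry.Resolution.exists_topologicalKrullDim_le_of_locallyOfFiniteType`
(cover by finitely many affine opens, each a closed subscheme of an affine space; Stacks 01TB with
00OS) gives the bound.  The composition `ModificationsResolve_of` of the line starts its
well-founded induction at the level `N := d + 1 > dim X`.
-/

set_option linter.dupNamespace false -- mandated namespace of this single-conjunct summit

noncomputable section

open CategoryTheory AlgebraicGeometry TopologicalSpace
open Literature.AlgebraicGeometry.Resolution

namespace Summit.ResolutionOfSingularities.ResolutionOfSingularities.Theorems.ModificationsResolve.Sketch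

/-- **Finite type over a field ⇒ finite dimensional.** For `X` quasi-compact and locally of
finite type over `Spec k` (`k` a field) there is `d : ℕ` with `topologicalKrullDim X ≤ d`:
`QuasiCompact f` over the affine base is `CompactSpace X`
(`HasAffineProperty.iff_of_isAffine`), and a compact scheme locally of finite type over a field
is covered by finitely many affine opens, each a closed subscheme of an affine space
(`exists_topologicalKrullDim_le_of_locallyOfFiniteType`). [folklore] -/
theorem stub_exists_nat_topologicalKrullDim_le {k : Type} [Field k] {X : Scheme.{0}}
    (f : X ⟶ Spec (.of k)) [LocallyOfFiniteType f] [QuasiCompact f] :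
    ∃ d : ℕ, topologicalKrullDim X ≤ (d : WithBot ℕ∞) := by
  haveI : CompactSpace X :=
    (HasAffineProperty.iff_of_isAffine (P := @QuasiCompact)).mp ‹QuasiCompact f›
  exact exists_topologicalKrullDim_le_of_locallyOfFiniteType f

end Summit.ResolutionOfSingularities.ResolutionOfSingularities.Theorems.ModificationsResolve.Sketch

end
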